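import Summits.QuantumAdvantage.QuantumAdvantage.Theorems.RingHorizon
import HarnessLib

/-!
# RingHorizonJunta (decomp-qadv lens-2 g10): the WINDOW + JUNTA exactness law at linear parameters

The tree floor `ringLocalJunta_polylog_lt3` (radius `w`, common junta `J`, both `≤ (log₂ N)^C`, mass form) has an EXACTNESS
companion at LINEAR parameters: `8w + 4|J| + 15 ≤ N` ⇒ some odd pattern violates the ring relation (via `RingHorizon.fanIn_loss`).
Lands after `RingHorizon.lean`; the text elaborates verbatim as §3J of the node file HorizonDial.lean (rc 0).
-/

namespace Summit.QuantumAdvantage.AdviceFreeQNC0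

open Finset

namespace RingHorizon

open Literature.Computability.QuantumComplexity Literature.Computability.QuantumComplexity.RingHLF

/-- Cyclic balls are small: a letter at cyclic distance `≤ w` from `g` is one of the `2w+1` letters `g-w, …, g+w`. -/
theorem near_mem_image {N w : ℕ} (hw : w < N) (g j : Fin N)
    (h : (j.val + N - g.val) % N ≤ w ∨ (g.val + N - j.val) % N ≤ w) :
    j ∈ (range (2 * w + 1)).image (fun i => (⟨(g.val + N - w + i) % N, Nat.mod_lt _ (by omega)⟩ : Fin N)) := by
  rw [mem_image]
  have hj := j.isLt
  have hg := g.isLt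
  have e1 : (j.val + N - g.val) % N = if g.val ≤ j.val then j.val - g.val else j.val + N - g.val := by
    split_ifs with hle
    · rw [show j.val + N - g.val = (j.val - g.val) + N by omega, Nat.add_mod_right, Nat.mod_eq_of_lt (by omega)]
    · rw [Nat.mod_eq_of_lt (by omega)]
  have e2 : (g.val + N - j.val) % N = if j.val ≤ g.val then g.val - j.val else g.val + N - j.val := by
    split_ifs with hle
    · rw [show g.val + N - j.val = (g.val - j.val) + N by omega, Nat.add_mod_right, Nat.mod_eq_of_lt (by omega)]
    · rw [Nat.mod_eq_of_lt (by omega)]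
  rw [e1, e2] at h
  -- the offset `i` and the multiple of `N` absorbed by `% N`
  have key : ∃ i, i < 2 * w + 1 ∧ (g.val + N - w + i = j.val + N ∨ g.val + N - w + i = j.val + 2 * N ∨
      g.val + N - w + i = j.val) := by
    by_cases hle : g.val ≤ j.val
    · rw [if_pos hle] at h
      by_cases hle' : j.val ≤ g.val
      · rw [if_pos hle'] at h
        exact ⟨w, by omega, Or.inl (by omega)⟩
      · rw [if_neg hle'] at h
        rcases h with h | h
        · exact ⟨j.val - g.val + w, by omega, Or.inl (by omega)⟩
        · exact ⟨j.val + w - g.val - N, by omega, Or.inr (Or.inr (by omega))⟩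
    · rw [if_neg hle, if_pos (by omega)] at h
      rcases h with h | h
      · exact ⟨j.val + N - g.val + w, by omega, Or.inr (Or.inl (by omega))⟩
      · exact ⟨w - (g.val - j.val), by omega, Or.inl (by omega)⟩
  obtain ⟨i, hi, hcases⟩ := key
  refine ⟨i, mem_range.2 hi, Fin.ext ?_⟩
  show (g.val + N - w + i) % N = j.val
  rcases hcases with e | e | e
  · rw [e, Nat.add_mod_right, Nat.mod_eq_of_lt hj]
  · rw [e, Nat.add_mul_mod_self_right, Nat.mod_eq_of_lt hj]
  · rw [e, Nat.mod_eq_of_lt hj]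

/-- **WINDOW + JUNTA LAW (the tree floor's hypothesis shape, linear parameters).**  If output `k` reads only the letters at
cyclic distance `≤ w` from `k` and the letters of a common junta `J`, and `8w + 4|J| + 15 ≤ N`, the strategy is not perfect on
the odd class (tree: `ringLocalJunta_polylog_lt3` at `w, |J| ≤ (log₂ N)^C`, mass form).  Via the fan-in law. -/
theorem windowJunta_loss {N w : ℕ} (J : Finset (Fin N)) (hN : 8 * w + 4 * J.card + 15 ≤ N)
    (z : (Fin N → Bool) → Fin N → Bool)
    (hz : ∀ x x' : Fin N → Bool, ∀ k : Fin N,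
      (∀ j : Fin N, (((j.val + N - k.val) % N ≤ w ∨ (k.val + N - j.val) % N ≤ w) ∨ j ∈ J) → x j = x' j) →
        z x k = z x' k) :
    ∃ x : Fin N → Bool, OddZeros x ∧ ¬ Rel x (z x) := by
  apply fanIn_loss (f := 2 * w + 1 + J.card) (by omega) z
  intro g
  refine ⟨(range (2 * w + 1)).image (fun i => (⟨(g.val + N - w + i) % N, Nat.mod_lt _ (by omega)⟩ : Fin N)) ∪ J,
    ?_, fun x x' hagree => hz x x' g fun j hj => hagree j ?_⟩
  · refine (card_union_le _ _).trans (Nat.add_le_add_right ?_ _)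
    exact card_image_le.trans (by rw [card_range])
  · rcases hj with hnear | hJ
    · exact mem_union_left _ (near_mem_image (by omega) g j hnear)
    · exact mem_union_right _ hJ


end RingHorizon

end Summit.QuantumAdvantage.AdviceFreeQNC0
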